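import Summits.AtomisticToContinuum.HydrodynamicLimit.Theorems.OneFlightGossipEngineEnergyCurrentTailsLossFloorGlue4
import HarnessLib

/-!
# The loss floor S1 from the lagged kinetic-window loss-intensity floor LIF₄ᴸ
# (stub `stub_lossFloor_of_lossIntensityFloor4L`, line `quartic-schur-ledger`,
# crux `EnergyCurrentTails`, stmt-AtomisticToContinuum-9235; seat c6 reshape A)

Registered stub `stub_lossFloor_of_lossIntensityFloor4L` (nickname S1-glue₄ᴸ) of the lead's skeleton
`Cruxes/EnergyCurrentTails/Lines/quartic_schur_ledger.lean` (primary crux decl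
`Summit.AtomisticToContinuum.HydrodynamicLimit.Theses.WarmColdDichotomy.EnergyCurrentTails`):
`S2 → LIF₄ᴸ → S1`, the re-run of the landed S1-glue₄ `stub_lossFloor_of_lossIntensityFloor4`
(module `…Theorems.OneFlightGossipEngineEnergyCurrentTailsLossFloorGlue4`) with the loss-intensity
floor now only on the LAGGED kinetic windows: the fast fourth moment is integrated over the first
HALF `(s, s + h/2]` of the window while the loss and the error term live on the full window
`(s, s + h]`, `h = (N+1)^{-1/3}`.

**Statement.**  Write `λ_N = localGibbsLaw σ a₀ u₀ θ₀ N (Φ N)`, `vᵢ(r) = ((Φ N).flow r z i).2`,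
`y(r) = m₄(r) = ∫ ofReal((N+1)⁻¹ ∑ᵢ ‖vᵢ(r)‖⁴) dλ_N`, `m₂, m₃` likewise,
`Loss(s,s′] = ∫ ofReal((N+1)⁻¹ collisionSum_{(s,s′]} (Δ₄)₋/2) dλ_N`, `Gain(s,s′]` with `(Δ₄)₊/2`,
`M₄^{>K₀}(r) = ∫ ofReal((N+1)⁻¹ ∑ᵢ 𝟙{K₀ < ‖vᵢ(r)‖} ‖vᵢ(r)‖⁴) dλ_N`, `ν_N = σ²(N+1)^{1/3}`,
`h = (N+1)^{-1/3}` (so `ν_N h = σ²`).  Assuming the sub-linear window gain ceiling S2 and the lagged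
loss-intensity floor LIF₄ᴸ
(`δ ν_N ∫_s^{s+h/2} M₄^{>K₀} ≤ Loss(s,s+h] + C ν_N h sup_{[s,s+h]} m₂ sup_{[s,s+h]} m₃` for
`0 ≤ s`, `s + h ≤ T`, eventually in `N`), and using the landed quartic datum bound Q0
(`stub_quarticData`) and window floor WF₄ (`stub_windowQuarticFloor4`,
`(s′−s) y(s) ≤ ∫_s^{s′} M₄^{>K₀} + (s′−s)K₀⁴ + (s′−s) Loss(s,s′]` for all `0 ≤ s ≤ s′`), the window
loss floor S1 holds: for `t < T` there are `τ = 1`, `c ∈ (0,1]`, `A ≥ 0`, `N₀` with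
`c · y_N(s) ≤ c · A + Loss_N(s, s + (N+1)^{-1/3}]` for `N ≥ N₀`, `s ∈ [0,t]`.

**Proof.**  Horizon `t + 2` in LIF₄ᴸ.  WF₄ on the HALF window `(s, s + h/2]` gives
`(h/2) y(s) ≤ ∫_s^{s+h/2} M₄^{>K₀} + (h/2) K₀⁴ + (h/2) Loss(s, s+h/2]`, and
`Loss(s, s+h/2] ≤ Loss(s, s+h]` (`windowFloor_lintegral_loss_mono`); multiplying by `δν_N`
(`δ ν_N h/2 = δσ²/2 =: κ`) and using LIF₄ᴸ: `κ y(s) ≤ (1+κ) Loss(s,s+h] + κ K₀⁴ + Cσ² sup m₂ sup m₃`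
(`lossFloorGlue_core`).  From here verbatim as in the landed S1-glue₄ (i.e. with `δ ↦ δ/2`):
`m₂ ≤ 1 + B` (`lintegral_normSqAvg_le`), `m₃ ≤ (l/2) y + m₂/(2l)` (`lintegral_cubicAvg_le`),
`Y = sup y ≤ y(s) + D + Y/2` (ledger `stub_quarticLedger` + S2 on sub-windows at slope `η = 1/2`,
`Y < ∞` by Q0); absorbing with `Cσ²(1+B) l ≤ κ/4` (`l = κ/(4(Cσ²(1+B)+1))`) leaves
`(κ/2) y(s) ≤ (1+κ) Loss + R`, i.e. S1 with `c = (κ/2)/(1+κ)`, `A = R/(κ/2)`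
(`lossFloorGlue_ennreal`; the window bookkeeping is `lossFloorGlue4L_window`, the lagged variant
of `lossFloorGlue4_window`).
References: Bobylev 1997; Mischler–Wennberg 1999; Mischler–Mouhot 2013 (Povzner-type quartic
bookkeeping with truncation at a velocity threshold).
-/

noncomputable section

open MeasureTheory Set Filter
open scoped ENNReal InnerProductSpace

namespace Summit.AtomisticToContinuum.HydrodynamicLimit.Theorems.QuarticSchurLedger

open Literature.MathematicalPhysics.KineticTheory Literature.Analysis.FluidPDE

/-- **The window assembly, lagged fourth-moment variant** (abstract form of the stub over one
window `[s, s + h]`, `h = x₃⁻¹`).  For contents `y, m₂, m₃ ≥ 0`, window gain/loss `G r = Gain(s,r]`,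
`L r = Loss(s,r]` and the fast fourth moment `I` integrated over the half window `(s, s + h/2]`:
the ledger `y r + L r = y s + G r`, the gain ceiling `G r ≤ D + η sup_{[s,r]} y` (`η ≤ 1/2`), the
crude bound `y ≤ B′`, the datum bound `y 0 ≤ B`, the moment bounds `m₂ ≤ 1 + y 0`,
`m₃ ≤ (l/2) y + m₂/(2l)`, WF₄ on the half window (`(h/2) y s ≤ I + (h/2) K₀⁴ + (h/2) L (s + h/2)`),
the loss monotonicity `L (s + h/2) ≤ L (s + h)` and LIF₄ᴸ
(`δσ²x₃ I ≤ L (s + h) + Cσ²x₃h sup m₂ sup m₃`) give `c · y s ≤ c · A + L (s + h)` with the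
explicit `c = (κ/2)/(1+κ)`, `κ = δσ²/2`, and `A`. [folklore] -/
theorem lossFloorGlue4L_window {y m₂ m₃ G L : ℝ → ℝ≥0∞} {I : ℝ≥0∞}
    {s h x3 δ σ K₀ C B B' D η l κ : ℝ}
    (hx3 : 0 < x3) (hx3h : x3 * h = 1) (hδ : 0 < δ) (hσ : 0 < σ) (hκ : κ = δ * σ ^ 2 / 2)
    (hC : 0 ≤ C) (hB : 0 ≤ B) (hD : 0 ≤ D) (hη0 : 0 ≤ η) (hη : η ≤ 1 / 2) (hl : 0 < l)
    (hlκ : C * σ ^ 2 * (1 + B) * l ≤ κ / 4)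
    (hbdd : ∀ r, y r ≤ ENNReal.ofReal B') (hy0 : y 0 ≤ ENNReal.ofReal B)
    (hm₂ : ∀ r, m₂ r ≤ 1 + y 0)
    (hm₃ : ∀ r, m₃ r ≤ ENNReal.ofReal (l / 2) * y r + ENNReal.ofReal (1 / (2 * l)) * m₂ r)
    (hled : ∀ r ∈ Icc s (s + 1 * h), y r + L r = y s + G r)
    (hgain : ∀ r ∈ Icc s (s + 1 * h),
      G r ≤ ENNReal.ofReal D + ENNReal.ofReal η * ⨆ r' ∈ Icc s r, y r')
    (hWF : ENNReal.ofReal (s + h / 2 - s) * y s ≤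
      I + ENNReal.ofReal ((s + h / 2 - s) * K₀ ^ 4) +
        ENNReal.ofReal (s + h / 2 - s) * L (s + h / 2))
    (hLmono : L (s + h / 2) ≤ L (s + 1 * h))
    (hLIF : ENNReal.ofReal (δ * (σ ^ 2 * x3)) * I ≤
      L (s + h) + ENNReal.ofReal (C * (σ ^ 2 * x3 * (s + h - s))) *
        (⨆ r ∈ Icc s (s + h), m₂ r) * (⨆ r ∈ Icc s (s + h), m₃ r)) :
    ENNReal.ofReal (κ / 2 / (1 + κ)) * y s ≤
      ENNReal.ofReal (κ / 2 / (1 + κ) *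
          ((κ * K₀ ^ 4 + κ / 4 * D +
              C * σ ^ 2 * (1 + B) * (1 / (2 * l) * (1 + B))) / (κ / 2))) +
        L (s + 1 * h) := by
  -- normalise the window lengths and ends: `s + h/2 - s = h/2`, `s + h - s = h`, `s + h = s + 1·h`
  have hss : s + h / 2 - s = h / 2 := by ring
  rw [hss] at hWF
  have hss1 : s + h - s = h := by ring
  have hsh : s + h = s + 1 * h := by ring
  rw [hss1] at hLIF
  rw [hsh] at hLIF
  have hp : C * (σ ^ 2 * x3 * h) = C * σ ^ 2 := by linear_combination (C * σ ^ 2) * hx3h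
  rw [hp] at hLIF
  -- WF₄ on the half window, with the loss of the full window
  have hWF' : ENNReal.ofReal (h / 2) * y s ≤
      I + ENNReal.ofReal (h / 2 * K₀ ^ 4) + ENNReal.ofReal (h / 2) * L (s + 1 * h) :=
    hWF.trans (add_le_add le_rfl (mul_le_mul' le_rfl hLmono))
  clear hWF
  -- the second moments
  have hM2 : ∀ r, m₂ r ≤ ENNReal.ofReal (1 + B) := fun r => by
    rw [ENNReal.ofReal_add zero_le_one hB, ENNReal.ofReal_one]
    exact (hm₂ r).trans (add_le_add le_rfl hy0)
  have hS₂ : (⨆ r ∈ Icc s (s + 1 * h), m₂ r) ≤ ENNReal.ofReal (1 + B) :=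
    iSup₂_le fun r _ => hM2 r
  -- the third moments against the window supremum `Y` of the quartic content
  set Y : ℝ≥0∞ := ⨆ r ∈ Icc s (s + 1 * h), y r with hY_def
  have hyY : ∀ r ∈ Icc s (s + 1 * h), y r ≤ Y := fun r hr =>
    le_iSup₂ (f := fun r (_ : r ∈ Icc s (s + 1 * h)) => y r) r hr
  have hS₃ : (⨆ r ∈ Icc s (s + 1 * h), m₃ r) ≤
      ENNReal.ofReal (l / 2) * Y + ENNReal.ofReal (1 / (2 * l)) * ENNReal.ofReal (1 + B) :=
    iSup₂_le fun r hr => (hm₃ r).trans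
      (add_le_add (mul_le_mul' le_rfl (hyY r hr)) (mul_le_mul' le_rfl (hM2 r)))
  -- the window supremum against the window start (ledger + gain ceiling on sub-windows)
  have hYb : Y ≤ y s + ENNReal.ofReal D + ENNReal.ofReal η * Y := by
    refine iSup₂_le fun r hr => ?_
    calc y r ≤ y r + L r := le_self_add
      _ = y s + G r := hled r hr
      _ ≤ y s + (ENNReal.ofReal D + ENNReal.ofReal η * ⨆ r' ∈ Icc s r, y r') :=
          add_le_add le_rfl (hgain r hr)
      _ ≤ y s + (ENNReal.ofReal D + ENNReal.ofReal η * Y) := by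
          gcongr
          exact biSup_mono fun r' hr' => ⟨hr'.1, hr'.2.trans hr.2⟩
      _ = y s + ENNReal.ofReal D + ENNReal.ofReal η * Y := (add_assoc _ _ _).symm
  -- finiteness
  have hys : y s ≠ ⊤ := ne_top_of_le_ne_top ENNReal.ofReal_ne_top (hbdd s)
  have hYf : Y ≠ ⊤ := ne_top_of_le_ne_top ENNReal.ofReal_ne_top (iSup₂_le fun r _ => hbdd r)
  -- the clock cancels on the half window: `δ ν (h/2) = δσ²/2 = κ`
  have hka : δ * (σ ^ 2 * x3) * (h / 2) = κ := by
    rw [hκ]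
    linear_combination (δ * σ ^ 2 / 2) * hx3h
  have hkb : δ * (σ ^ 2 * x3) * (h / 2 * K₀ ^ 4) = κ * K₀ ^ 4 := by
    rw [hκ]
    linear_combination (δ * σ ^ 2 * K₀ ^ 4 / 2) * hx3h
  have hκ0 : 0 < κ := by
    rw [hκ]
    positivity
  exact lossFloorGlue_ennreal (by positivity) (by positivity) hκ0 (by positivity)
    (by positivity) hl hD hη0 hη hlκ hka hkb hys hYf hWF' hLIF hS₂ hS₃ hYb

/-- **Stub S1-glue₄ᴸ — THE LOSS FLOOR FROM THE LAGGED KINETIC-WINDOW LOSS-INTENSITY FLOOR** (glue)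
of the line `quartic-schur-ledger` (crux stmt-AtomisticToContinuum-9235, `EnergyCurrentTails`;
seat c6 reshape A): `S2 → LIF₄ᴸ → S1` (Q0 `stub_quarticData` and WF₄ `stub_windowQuarticFloor4`
are LANDED and used by name).  Assuming the sub-linear window gain ceiling S2 and the lagged
loss-intensity floor LIF₄ᴸ (`δ ν_N ∫_s^{s+h/2} M₄^{>K₀} ≤ Loss(s,s+h] + C ν_N h sup m₂ sup m₃` on
the kinetic windows `h = (N+1)^{-1/3}`, `s + h ≤ T`, `K₀ ≥ 0`), with the datum bound Q0 and the
window quartic floor WF₄ on the half window `(s, s+h/2]` plus the window monotonicity of the loss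
(`windowFloor_lintegral_loss_mono`), the window loss floor S1 holds in the frame of the crux: for
`t < T` there are `τ = 1`, `c ∈ (0,1]`, `A ≥ 0`, `N₀` with
`c · y_N(s) ≤ c · A + Loss_N(s, s + (N+1)^{-1/3}]` for `N ≥ N₀`, `s ∈ [0,t]`.  Constants: horizon
`t + 2` in LIF₄ᴸ, `κ = δσ²/2`, slope `η = 1/2` in S2, `l = κ/(4(Cσ²(1+B)+1))`, `c = (κ/2)/(1+κ)`;
the window bookkeeping is `lossFloorGlue4L_window` (ledger `stub_quarticLedger`,
`lintegral_normSqAvg_le`, `lintegral_cubicAvg_le`, probability of `λ_N` for `σ ≤ 1/2`).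
[folklore] -/
theorem stub_lossFloor_of_lossIntensityFloor4L :
    (∀ (a₀ θ₀ : T3 → ℝ) (u₀ : T3 → V3), Continuous a₀ → Continuous θ₀ → Continuous u₀ → (∀ x, 0 < a₀ x) → (∀
    x, 0 < θ₀ x) → ∃ σ₀ : ℝ, 0 < σ₀ ∧ ∀ σ : ℝ, 0 < σ → σ < σ₀ → ∀ (T : ℝ) (ρ θ : ℝ → T3 → ℝ) (u : ℝ → T3 →
    V3), IsHardSphereEulerSolution σ T ρ u θ → ∀ Φ : (N : ℕ) → HardSphereFlow (Torus.geometry (Fin 3))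
    (hsDiameter σ N) (N + 1), TendstoHydroFieldsAt (fun N => localGibbsLaw σ a₀ u₀ θ₀ N (Φ N)) Φ ρ u θ 0 → ∀
    t ∈ Set.Ico 0 T, ∀ τ : ℝ, 0 < τ → ∀ η : ℝ, 0 < η → ∃ D : ℝ, 0 ≤ D ∧ ∃ N₀ : ℕ, ∀ N : ℕ, N₀ ≤ N → ∀ s ∈
    Set.Icc 0 t, ∀ s' ∈ Set.Icc s (s + τ * ((N : ℝ) + 1) ^ (-(1 / 3 : ℝ))), (∫⁻ z, ENNReal.ofReal (((N : ℝ)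
    + 1)⁻¹ * (Φ N).collisionSum (Set.Ioc s s') (fun col => max (‖col.postVel.1‖ ^ 4 + ‖col.postVel.2‖ ^ 4 -
    ‖col.preVel.1‖ ^ 4 - ‖col.preVel.2‖ ^ 4) 0 / 2) z) ∂(localGibbsLaw σ a₀ u₀ θ₀ N (Φ N))) ≤ ENNReal.ofReal
    D + ENNReal.ofReal η * ⨆ r ∈ Set.Icc s s', (∫⁻ z, ENNReal.ofReal (((N : ℝ) + 1)⁻¹ * ∑ i : Fin (N + 1),
    ‖((Φ N).flow r z i).2‖ ^ 4) ∂(localGibbsLaw σ a₀ u₀ θ₀ N (Φ N)))) → (∀ (a₀ θ₀ : T3 → ℝ) (u₀ : T3 → V3),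
    Continuous a₀ → Continuous θ₀ → Continuous u₀ → (∀ x, 0 < a₀ x) → (∀ x, 0 < θ₀ x) → ∃ σ₀ : ℝ, 0 < σ₀ ∧ ∀
    σ : ℝ, 0 < σ → σ < σ₀ → ∀ T : ℝ, 0 < T → ∀ Φ : ((N : ℕ) → HardSphereFlow (Torus.geometry (Fin 3))
    (hsDiameter σ N) (N + 1)), ∃ δ : ℝ, 0 < δ ∧ ∃ K₀ : ℝ, 0 ≤ K₀ ∧ ∃ C : ℝ, 0 ≤ C ∧ ∃ N₀ : ℕ, ∀ N : ℕ, N₀ ≤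
    N → ∀ s : ℝ, 0 ≤ s → s + ((N : ℝ) + 1) ^ (-(1 / 3 : ℝ)) ≤ T → ENNReal.ofReal (δ * (σ ^ 2 * ((N : ℝ) + 1)
    ^ (1 / 3 : ℝ))) * (∫⁻ r in Set.Ioc s (s + ((N : ℝ) + 1) ^ (-(1 / 3 : ℝ)) / 2), (∫⁻ z, ENNReal.ofReal
    (((N : ℝ) + 1)⁻¹ * ∑ i : Fin (N + 1), (if K₀ < ‖((Φ N).flow r z i).2‖ then ‖((Φ N).flow r z i).2‖ ^ 4
    else 0)) ∂(localGibbsLaw σ a₀ u₀ θ₀ N (Φ N)))) ≤ (∫⁻ z, ENNReal.ofReal (((N : ℝ) + 1)⁻¹ * (Φ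
    N).collisionSum (Set.Ioc s (s + ((N : ℝ) + 1) ^ (-(1 / 3 : ℝ)))) (fun col => max (‖col.preVel.1‖ ^ 4 +
    ‖col.preVel.2‖ ^ 4 - ‖col.postVel.1‖ ^ 4 - ‖col.postVel.2‖ ^ 4) 0 / 2) z) ∂(localGibbsLaw σ a₀ u₀ θ₀ N
    (Φ N))) + ENNReal.ofReal (C * (σ ^ 2 * ((N : ℝ) + 1) ^ (1 / 3 : ℝ) * (s + ((N : ℝ) + 1) ^ (-(1 / 3 : ℝ))
    - s))) * (⨆ r ∈ Set.Icc s (s + ((N : ℝ) + 1) ^ (-(1 / 3 : ℝ))), (∫⁻ z, ENNReal.ofReal (((N : ℝ) + 1)⁻¹ *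
    ∑ i : Fin (N + 1), ‖((Φ N).flow r z i).2‖ ^ 2) ∂(localGibbsLaw σ a₀ u₀ θ₀ N (Φ N)))) * (⨆ r ∈ Set.Icc s
    (s + ((N : ℝ) + 1) ^ (-(1 / 3 : ℝ))), (∫⁻ z, ENNReal.ofReal (((N : ℝ) + 1)⁻¹ * ∑ i : Fin (N + 1), ‖((Φ
    N).flow r z i).2‖ ^ 3) ∂(localGibbsLaw σ a₀ u₀ θ₀ N (Φ N))))) → (∀ (a₀ θ₀ : T3 → ℝ) (u₀ : T3 → V3),
    Continuous a₀ → Continuous θ₀ → Continuous u₀ → (∀ x, 0 < a₀ x) → (∀ x, 0 < θ₀ x) → ∃ σ₀ : ℝ, 0 < σ₀ ∧ ∀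
    σ : ℝ, 0 < σ → σ < σ₀ → ∀ (T : ℝ) (ρ θ : ℝ → T3 → ℝ) (u : ℝ → T3 → V3), IsHardSphereEulerSolution σ T ρ
    u θ → ∀ Φ : (N : ℕ) → HardSphereFlow (Torus.geometry (Fin 3)) (hsDiameter σ N) (N + 1),
    TendstoHydroFieldsAt (fun N => localGibbsLaw σ a₀ u₀ θ₀ N (Φ N)) Φ ρ u θ 0 → ∀ t ∈ Set.Ico 0 T, ∃ τ : ℝ,
    0 < τ ∧ ∃ c : ℝ, 0 < c ∧ c ≤ 1 ∧ ∃ A : ℝ, 0 ≤ A ∧ ∃ N₀ : ℕ, ∀ N : ℕ, N₀ ≤ N → ∀ s ∈ Set.Icc 0 t,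
    ENNReal.ofReal c * (∫⁻ z, ENNReal.ofReal (((N : ℝ) + 1)⁻¹ * ∑ i : Fin (N + 1), ‖((Φ N).flow s z i).2‖ ^
    4) ∂(localGibbsLaw σ a₀ u₀ θ₀ N (Φ N))) ≤ ENNReal.ofReal (c * A) + (∫⁻ z, ENNReal.ofReal (((N : ℝ) +
    1)⁻¹ * (Φ N).collisionSum (Set.Ioc s (s + τ * ((N : ℝ) + 1) ^ (-(1 / 3 : ℝ)))) (fun col => max
    (‖col.preVel.1‖ ^ 4 + ‖col.preVel.2‖ ^ 4 - ‖col.postVel.1‖ ^ 4 - ‖col.postVel.2‖ ^ 4) 0 / 2) z)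
    ∂(localGibbsLaw σ a₀ u₀ θ₀ N (Φ N)))) := by
  intro hS2 hLIF a₀ θ₀ u₀ ha hθ hu ha0 hθ0
  have hQ0 := stub_quarticData
  have hWF := stub_windowQuarticFloor4
  obtain ⟨σ₁, hσ₁, H1⟩ := hS2 a₀ θ₀ u₀ ha hθ hu ha0 hθ0
  obtain ⟨σ₂, hσ₂, H2⟩ := hQ0 a₀ θ₀ u₀ ha hθ hu ha0 hθ0
  obtain ⟨σ₃, hσ₃, H3⟩ := hLIF a₀ θ₀ u₀ ha hθ hu ha0 hθ0
  have HW := hWF a₀ θ₀ u₀ ha hθ hu ha0 hθ0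
  clear hS2 hQ0 hLIF hWF
  refine ⟨min (min σ₁ (min σ₂ σ₃)) (1 / 2), by positivity, ?_⟩
  intro σ hσ hσ0 T ρ θ u hE Φ h0 t ht
  have hσ₁' : σ < σ₁ := hσ0.trans_le ((min_le_left _ _).trans (min_le_left _ _))
  have hσ₂' : σ < σ₂ :=
    hσ0.trans_le ((min_le_left _ _).trans ((min_le_right _ _).trans (min_le_left _ _)))
  have hσ₃' : σ < σ₃ :=
    hσ0.trans_le ((min_le_left _ _).trans ((min_le_right _ _).trans (min_le_right _ _)))
  have hσh : σ < 1 / 2 := hσ0.trans_le (min_le_right _ _)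
  -- the constants: LIF₄ᴸ on the horizon `t + 2`, Q0, S2 at `τ = 1`, `η = 1/2`, `κ = δσ²/2`
  have hT' : 0 < t + 2 := by linarith [ht.1]
  obtain ⟨δ, hδ, K₀, hK₀, C, hC, N₁, HL⟩ := H3 σ hσ hσ₃' (t + 2) hT' Φ
  obtain ⟨B, hB, N₂, HQ⟩ := H2 σ hσ hσ₂' Φ
  obtain ⟨D, hD, N₃, HS⟩ := H1 σ hσ hσ₁' T ρ θ u hE Φ h0 t ht 1 one_pos (1 / 2) (by norm_num)
  obtain ⟨κ, hκ_def⟩ : ∃ κ : ℝ, κ = δ * σ ^ 2 / 2 := ⟨_, rfl⟩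
  have hκ : 0 < κ := by
    rw [hκ_def]
    positivity
  have hP : 0 < C * σ ^ 2 * (1 + B) + 1 := by positivity
  obtain ⟨l, hl_def⟩ : ∃ l : ℝ, l = κ / (4 * (C * σ ^ 2 * (1 + B) + 1)) := ⟨_, rfl⟩
  have hl : 0 < l := by
    rw [hl_def]
    positivity
  have hlκ : C * σ ^ 2 * (1 + B) * l ≤ κ / 4 := by
    rw [hl_def, mul_div_assoc', div_le_div_iff₀ (by positivity) (by norm_num)]
    nlinarith [hκ.le, hP.le]
  refine ⟨1, one_pos, κ / 2 / (1 + κ), by positivity,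
    (div_le_one (by positivity)).2 (by linarith),
    (κ * K₀ ^ 4 + κ / 4 * D + C * σ ^ 2 * (1 + B) * (1 / (2 * l) * (1 + B))) / (κ / 2),
    by positivity, max N₁ (max N₂ N₃), fun N hN s hs => ?_⟩
  have hN₁ : N₁ ≤ N := (le_max_left _ _).trans hN
  have hN₂ : N₂ ≤ N := ((le_max_left _ _).trans (le_max_right _ _)).trans hN
  have hN₃ : N₃ ≤ N := ((le_max_right _ _).trans (le_max_right _ _)).trans hN
  obtain ⟨hQ4, B', hB'⟩ := HQ N hN₂
  haveI := isProbabilityMeasure_localGibbsLaw ha hθ hu ha0 hθ0 hσh.le N (Φ N)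
  have hgood := ae_mem_good_localGibbsLaw σ a₀ u₀ θ₀ N (Φ N)
  -- the window `h = (N+1)^{-1/3}` and its first half
  have hx : (0 : ℝ) < (N : ℝ) + 1 := by positivity
  have hx1 : (1 : ℝ) ≤ (N : ℝ) + 1 := le_add_of_nonneg_left (Nat.cast_nonneg N)
  have hh : 0 < ((N : ℝ) + 1) ^ (-(1 / 3 : ℝ)) := Real.rpow_pos_of_pos hx _
  have hx3 : 0 < ((N : ℝ) + 1) ^ (1 / 3 : ℝ) := Real.rpow_pos_of_pos hx _
  have hx3h : ((N : ℝ) + 1) ^ (1 / 3 : ℝ) * ((N : ℝ) + 1) ^ (-(1 / 3 : ℝ)) = 1 := by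
    rw [Real.rpow_neg hx.le, mul_inv_cancel₀ hx3.ne']
  have hh1 : ((N : ℝ) + 1) ^ (-(1 / 3 : ℝ)) ≤ 1 :=
    Real.rpow_le_one_of_one_le_of_nonpos hx1 (by norm_num)
  have hs0 : 0 ≤ s := hs.1
  have hss2 : s ≤ s + ((N : ℝ) + 1) ^ (-(1 / 3 : ℝ)) / 2 := by linarith
  have hs2s' : s + ((N : ℝ) + 1) ^ (-(1 / 3 : ℝ)) / 2 ≤ s + 1 * ((N : ℝ) + 1) ^ (-(1 / 3 : ℝ)) := by
    linarith
  have hs'T : s + ((N : ℝ) + 1) ^ (-(1 / 3 : ℝ)) ≤ t + 2 := by linarith [hs.2]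
  exact lossFloorGlue4L_window
    (y := fun r => ∫⁻ z, ENNReal.ofReal (((N : ℝ) + 1)⁻¹ *
        ∑ i : Fin (N + 1), ‖((Φ N).flow r z i).2‖ ^ 4) ∂(localGibbsLaw σ a₀ u₀ θ₀ N (Φ N)))
    (m₂ := fun r => ∫⁻ z, ENNReal.ofReal (((N : ℝ) + 1)⁻¹ *
        ∑ i : Fin (N + 1), ‖((Φ N).flow r z i).2‖ ^ 2) ∂(localGibbsLaw σ a₀ u₀ θ₀ N (Φ N)))
    (m₃ := fun r => ∫⁻ z, ENNReal.ofReal (((N : ℝ) + 1)⁻¹ *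
        ∑ i : Fin (N + 1), ‖((Φ N).flow r z i).2‖ ^ 3) ∂(localGibbsLaw σ a₀ u₀ θ₀ N (Φ N)))
    (G := fun r => ∫⁻ z, ENNReal.ofReal (((N : ℝ) + 1)⁻¹ *
        (Φ N).collisionSum (Set.Ioc s r)
          (fun col => max (‖col.postVel.1‖ ^ 4 + ‖col.postVel.2‖ ^ 4
            - ‖col.preVel.1‖ ^ 4 - ‖col.preVel.2‖ ^ 4) 0 / 2) z)
      ∂(localGibbsLaw σ a₀ u₀ θ₀ N (Φ N)))
    (L := fun r => ∫⁻ z, ENNReal.ofReal (((N : ℝ) + 1)⁻¹ *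
        (Φ N).collisionSum (Set.Ioc s r)
          (fun col => max (‖col.preVel.1‖ ^ 4 + ‖col.preVel.2‖ ^ 4
            - ‖col.postVel.1‖ ^ 4 - ‖col.postVel.2‖ ^ 4) 0 / 2) z)
      ∂(localGibbsLaw σ a₀ u₀ θ₀ N (Φ N)))
    hx3 hx3h hδ hσ hκ_def hC hB hD (by norm_num) le_rfl hl hlκ hB' hQ4
    (fun r => lintegral_normSqAvg_le (Φ N) _ hgood r)
    (fun r => lintegral_cubicAvg_le (Φ N) _ r hl)
    (fun r hr => stub_quarticLedger a₀ θ₀ u₀ σ hσ hσh N (Φ N) s r hs0 hr.1)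
    (HS N hN₃ s hs)
    (HW σ hσ hσh N (Φ N) K₀ hK₀ s _ hs0 hss2)
    (windowFloor_lintegral_loss_mono a₀ θ₀ u₀ (Φ N) hss2 hs2s')
    (HL N hN₁ s hs0 hs'T)

end Summit.AtomisticToContinuum.HydrodynamicLimit.Theorems.QuarticSchurLedger

end
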